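import Summits.QuantumFields.YangMills.Theorems.BalabanUVNodesN18HLayerW1TwoRadiiReading
import Summits.QuantumFields.YangMills.Theorems.BalabanUVNodesN18HLayerW1TermIndexed

/-!
# BalabanUVNodes ∕ N18 — THE TWO-TABLE CHAIN IN THE TERM CURRENCIES: (GEN-T₂) ⟹ (GEN₂) and the term-indexed generator's per-term schemas on a table PAIR (the terms
# analytic ∕ (2.26)-bounded on print's LARGER table `sp′ (k+1)`, the older terms admissible on `sp`) (Track A, DAG node N18 = NE5 `T4OutputRate.NE5 EA EB W κ θ C₅` :211;
# cluster K4 «SpineRates»; file 24 of seat pub-ymgap-dag-n18-c, row s1, generation 5; companion of files 22 ∕ 23)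

Cell `pub-ymgap`, HUMAN RULING D-0062 (Track A), R134 ACCELERATION seat `pub-ymgap-dag-n18-c` (strategy s1), generation 5.  THEOREMS ONLY (no `def` ∕ `instance` ∕
`sorry`); imports files 22 `…N18HLayerW1TwoRadiiReading` and 23 `…N18HLayerW1TermIndexed` BY NAME; restates nothing.  K3‴ helper.

WHY.  Files 21 ∕ 22 moved the (STEP) and (GEN) currencies of the configuration-direction chain to print's table PAIR ([II] p. 15: the step's H-layer pair on the larger
(i)–(iii)-space, the inductive assumptions on `U^c(X, α₀, α₁)`); file 23 collapsed (GEN-T) at node00-def-W1's term-indexed generator to two per-term schemas.  THIS FILE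
closes the square: the TERM currencies on a pair — (GEN-T₂) «admissible older terms ON `sp` ⟹ (2.14) termwise analyticity + domination + (2.26) per term ON `sp′ (k+1)`»
⟹ (GEN₂) (file 18 §1's proof: a finite sum of analytic terms + file 12's Lemma-3 socket, which lives on ONE table — the step's), and at `GenTower.ofTerms L T` the per-term
schemas (T-an₂) ∕ (T-226₂) on `sp′` ⟹ (GEN₂) ⟹ W1's `RecAdmissible` on `sp` (file 22 §3).

WHAT (theorems only).
* §1 `stepGen_of_stepGenT₂` ((GEN-T₂) ⟹ (GEN₂), `A = C₃ε₁`, `R = (1−8δ)·½L·κ`), `recAdmissible_of_stepGenT₂` (file 22 §3 ∘ §1).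
* §2 `stepGen_ofTerms_of_termwise₂` ((T-an₂) + (T-226₂) ⟹ (GEN₂) at `GenTower.ofTerms L T`; domination = W1's `norm_H_ofTerms_le`), `recAdmissible_ofTerms_of_termwise₂`,
  `decayBound_EA_ofRecordAdm_ofTerms_of_termwise₂` (L05 at the admissible pairing of record, readings in `sp k`, terms' schemas on the larger `spA′`).
* §3 ★★ `recAdmissible_ofTerms_of_termwise₂_consts` — at the tree's witness numerals (file 19): (T-an₂) + (T-226₂) on `sp′` + print's clause ONLY.

HONEST FRAMING.  Count-neutral kernel bookkeeping (file 18 §1's proof with `sp′`; compositions with files 22 ∕ 23); NOT a discharge of N18 (typed 28∕28 · discharged 5∕27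
UNCHANGED); the per-term schemas on the larger table are NODE A's ∕ N10's content, DISPLAYED; NE5 NOT IN PRINT ∕ NOT PROVED; finite four-torus at fixed ε — NOT infinite
volume ∕ OS ∕ mass gap ∕ Clay.  0 `sorry`, 0 `def`, standard axioms.

References (TYPES only): [II] = [Balaban1988RG2Cluster] (2.9)–(2.11) p. 14, (2.14) p. 15, p. 15 (the restriction), (2.26) p. 17, Lemma 3 (2.38) p. 20, p. 22; [I] =
[Balaban1987RG1] §1 p. 263, Thm 1 p. 259.
-/

noncomputable section

namespace Summit.QuantumFields.YangMills.BalabanUVNodes.N18HLayerW1TwoRadiiTerms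

open Set Metric
open scoped BigOperators Matrix.Norms.L2Operator
open Literature.MathematicalPhysics.QuantumFieldTheory.Balaban1983to89
open Literature.MathematicalPhysics.QuantumFieldTheory.Balaban1983to89.T4Continuum (T4Family)
open Literature.MathematicalPhysics.QuantumFieldTheory.Balaban1983to89.T4OutputRate
open Literature.MathematicalPhysics.QuantumFieldTheory.Balaban1983to89.TreeLengthTorus (TDom)
open Literature.MathematicalPhysics.QuantumFieldTheory.Balaban1983to89.B12TreeDecay (K₀)
open Literature.MathematicalPhysics.QuantumFieldTheory.Balaban1983to89.B13Lemma3TorusData (TBond)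
open Literature.MathematicalPhysics.QuantumFieldTheory.Balaban1983to89.B13Lemma3TorusTerms (terms weight)
open Literature.MathematicalPhysics.QuantumFieldTheory.Balaban1983to89.B13Lemma3TorusSocket (Lemma3Numerics)
open Literature.MathematicalPhysics.QuantumFieldTheory.Balaban1983to89.Node00
open Literature.MathematicalPhysics.QuantumFieldTheory.Balaban1983to89.Node00.Sect2 (domSys domCount CPair ofBackgroundC)
open Literature.MathematicalPhysics.QuantumFieldTheory.Balaban1983to89.Node00.W1
open Summit.QuantumFields.YangMills.BalabanUVNodes.N18HLayerW1Lemma3Config (bound238_of_termwise226_config)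
open Summit.QuantumFields.YangMills.BalabanUVNodes.N18HLayerW1TwoRadiiReading (recAdmissible_of_stepGen₂ decayBound_EA_ofRecordAdm_toClusterTower_of_stepGen₂)
open Summit.QuantumFields.YangMills.BalabanUVNodes.N18HLayerW1TermIndexed (stepGenT_ofTerms_of_termwise)

/-! ## §1 (GEN-T₂) ⟹ (GEN₂) -/

section StepT

variable (F : T4Family) (K : ℕ) {𝔸 : Type} [NormedRing 𝔸] [NormedAlgebra ℂ 𝔸] {M : ℕ} [NeZero M]

open Classical in
/-- **(GEN-T₂) ⟹ (GEN₂)**: for a generator tower `G`, two tables `sp` (older terms' admissibility) and `sp′` (the step), term maps `Tm` over `terms L M Z`: IF admissible older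
terms ON `sp` give (i) the generic terms analytic at the points of `sp′ (k+1) Z`, (ii) `‖H‖ ≤ Σ_τ ‖Tm τ‖` and (iii) `‖Tm τ‖ ≤ weight(τ)·e^{a₅|Z|}` ON `sp′ (k+1) Z`, THEN the
activities are analytic and (2.38)-bounded ON `sp′ (k+1)` (`A = C₃ε₁`, `R = (1−8δ)·½L·κ`) — file 18 §1's proof, the Lemma-3 socket read on the step's table.
[cite: Balaban1988RG2Cluster, (2.9)-(2.11) p.14, (2.14) p.15, (2.26) p.17 and Lemma 3 (2.38) p.20] -/
theorem stepGen_of_stepGenT₂ (G : GenTower (F.P K) 𝔸 M) (D : Set ℂ) (sp sp' : (j : ℕ) → (domSys (F.P K) M j).Dom → Set (CPair (F.P K) 𝔸))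
    {E₀ r₁ : ℝ} (c : B13.Consts) {L : ℕ} [NeZero L] (hL : 8 ≤ c.L) (hLc : c.L = L) {a a₂ a₂' a₅ Aabs : ℝ}
    (hN : Lemma3Numerics c M ((c.L : ℝ) / 2) a a₂ a₂' a₅ Aabs)
    (Tm : (k : ℕ) → ℂ → OlderTerms (F.P K) 𝔸 M k → (Z : TDom 4 (domCount (F.P K) M (k + 1))) →
      Finset (TDom 4 (L * domCount (F.P K) M (k + 1))) × Finset (TBond 4 M (L * domCount (F.P K) M (k + 1))) → CPair (F.P K) 𝔸 → ℂ)
    (hgenT : ∀ k : ℕ, ∀ t ∈ D, ∀ old : OlderTerms (F.P K) 𝔸 M k,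
      (∀ (j : Fin (k + 1)) (Y : (domSys (F.P K) M j).Dom), ∀ ψ ∈ sp j Y,
          ‖old j Y ψ‖ ≤ E₀ * Real.exp (-(r₁ * (domSys (F.P K) M j).dj Y))) →
      (∀ (j : Fin (k + 1)) (Y : (domSys (F.P K) M j).Dom), AnalyticOnNhd ℂ (old j Y) (sp j Y)) →
      (∀ (Z : (domSys (F.P K) M (k + 1)).Dom), ∀ i ∈ (G k).idx Z, AnalyticOnNhd ℂ (fun φ => (G k).T i t old φ) (sp' (k + 1) Z)) ∧
      (∀ (Z : (domSys (F.P K) M (k + 1)).Dom) (φ : CPair (F.P K) 𝔸), φ ∈ sp' (k + 1) Z →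
          ‖(G k).H t old φ Z‖ ≤ ∑ τ ∈ terms L M Z, ‖Tm k t old Z τ φ‖) ∧
      (∀ (Z : (domSys (F.P K) M (k + 1)).Dom) (φ : CPair (F.P K) 𝔸), φ ∈ sp' (k + 1) Z → ∀ τ ∈ terms L M Z,
          ‖Tm k t old Z τ φ‖ ≤ weight L M c Z a τ * Real.exp (a₅ * ((Z.1).card : ℝ)))) :
    ∀ k : ℕ, ∀ t ∈ D, ∀ old : OlderTerms (F.P K) 𝔸 M k,
      (∀ (j : Fin (k + 1)) (Y : (domSys (F.P K) M j).Dom), ∀ ψ ∈ sp j Y,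
          ‖old j Y ψ‖ ≤ E₀ * Real.exp (-(r₁ * (domSys (F.P K) M j).dj Y))) →
      (∀ (j : Fin (k + 1)) (Y : (domSys (F.P K) M j).Dom), AnalyticOnNhd ℂ (old j Y) (sp j Y)) →
      (∀ Z : (domSys (F.P K) M (k + 1)).Dom, AnalyticOnNhd ℂ (fun φ => (G k).H t old φ Z) (sp' (k + 1) Z)) ∧
      (∀ (Z : (domSys (F.P K) M (k + 1)).Dom), ∀ φ ∈ sp' (k + 1) Z,
          ‖(G k).H t old φ Z‖ ≤ c.C3act * c.ε₁ * Real.exp (-((1 - 8 * c.δ) * ((c.L : ℝ) / 2) * c.κ * (domSys (F.P K) M (k + 1)).dj Z))) := by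
  -- adapted from file 18 `stepGen_of_stepGenT` (the step's clauses and conclusions read on `sp′ (k+1)`)
  intro k t ht old hB hAn
  obtain ⟨hT, hdom, h226⟩ := hgenT k t ht old hB hAn
  refine ⟨fun Z => ?_, fun Z φ hφ => ?_⟩
  · have h := Finset.analyticOnNhd_sum ((G k).idx Z) (f := fun i φ => (G k).T i t old φ) fun i hi => hT Z i hi
    rw [Finset.sum_fn] at h
    simpa only [StepGen.H] using h
  · have h238 := bound238_of_termwise226_config F K
      (⟨(G k).Idx, (G k).idx, fun i _ φ => (G k).T i t old φ⟩ : ClusterStep (F.P K) 𝔸 M k) (Set.univ : Set (Fin (k + 1) → ℝ))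
      (sp' (k + 1)) c hL hLc hN (fun _ Z τ φ => Tm k t old Z τ φ) (fun _ _ Z φ hφ => hdom Z φ hφ) (fun _ _ Z φ hφ τ hτ => h226 Z φ hφ τ hτ)
    exact h238 (fun _ => 0) (Set.mem_univ _) Z φ hφ

open Classical in
/-- **W1's `RecAdmissible` ON `sp` FROM (GEN-T₂)** (file 22 §3 ∘ §1: print's clause `hrestr` between `sp` and `sp′`, ONE numerics bundle, the located clauses, the renewal).
[cite: Balaban1987RG1, §1 p.263 and Thm 1 p.259; Balaban1988RG2Cluster, (2.14) p.15, (2.26) p.17, p.15 and p.22] -/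
theorem recAdmissible_of_stepGenT₂ (G : GenTower (F.P K) 𝔸 M) (D : Set ℂ) (sp sp' : (j : ℕ) → (domSys (F.P K) M j).Dom → Set (CPair (F.P K) 𝔸))
    {E₀ r₁ : ℝ} (hrestr : ∀ k, ∀ X Z : (domSys (F.P K) M (k + 1)).Dom, Z.1 ⊆ X.1 → sp (k + 1) X ⊆ sp' (k + 1) Z)
    (c : B13.Consts) {L : ℕ} [NeZero L] (hL : 8 ≤ c.L) (hLc : c.L = L) {a a₂ a₂' a₅ Aabs : ℝ} (hN : Lemma3Numerics c M ((c.L : ℝ) / 2) a a₂ a₂' a₅ Aabs)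
    (Tm : (k : ℕ) → ℂ → OlderTerms (F.P K) 𝔸 M k → (Z : TDom 4 (domCount (F.P K) M (k + 1))) →
      Finset (TDom 4 (L * domCount (F.P K) M (k + 1))) × Finset (TBond 4 M (L * domCount (F.P K) M (k + 1))) → CPair (F.P K) 𝔸 → ℂ)
    (hgenT : ∀ k : ℕ, ∀ t ∈ D, ∀ old : OlderTerms (F.P K) 𝔸 M k,
      (∀ (j : Fin (k + 1)) (Y : (domSys (F.P K) M j).Dom), ∀ ψ ∈ sp j Y,
          ‖old j Y ψ‖ ≤ E₀ * Real.exp (-(r₁ * (domSys (F.P K) M j).dj Y))) →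
      (∀ (j : Fin (k + 1)) (Y : (domSys (F.P K) M j).Dom), AnalyticOnNhd ℂ (old j Y) (sp j Y)) →
      (∀ (Z : (domSys (F.P K) M (k + 1)).Dom), ∀ i ∈ (G k).idx Z, AnalyticOnNhd ℂ (fun φ => (G k).T i t old φ) (sp' (k + 1) Z)) ∧
      (∀ (Z : (domSys (F.P K) M (k + 1)).Dom) (φ : CPair (F.P K) 𝔸), φ ∈ sp' (k + 1) Z →
          ‖(G k).H t old φ Z‖ ≤ ∑ τ ∈ terms L M Z, ‖Tm k t old Z τ φ‖) ∧
      (∀ (Z : (domSys (F.P K) M (k + 1)).Dom) (φ : CPair (F.P K) 𝔸), φ ∈ sp' (k + 1) Z → ∀ τ ∈ terms L M Z,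
          ‖Tm k t old Z τ φ‖ ≤ weight L M c Z a τ * Real.exp (a₅ * ((Z.1).card : ℝ))))
    (hr₁ : 0 ≤ r₁) (hA : 0 ≤ c.C3act * c.ε₁) (hrate : r₁ + 2 * (64 * Real.log 162) + 2 ≤ (1 - 8 * c.δ) * ((c.L : ℝ) / 2) * c.κ)
    (hsmall : c.C3act * c.ε₁ * Real.exp (5 * r₁ + 1) * K₀ 64 8 * 9 * 64 < 1)
    (hrenew : Real.exp 1 * 9 * 64 * K₀ 64 8 ^ 2 * (c.C3act * c.ε₁) ≤ E₀) :
    RecAdmissible G D fun k => {old : OlderTerms (F.P K) 𝔸 M k |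
      (∀ (j : Fin (k + 1)) (Y : (domSys (F.P K) M j).Dom), ∀ ψ ∈ sp j Y,
          ‖old j Y ψ‖ ≤ E₀ * Real.exp (-(r₁ * (domSys (F.P K) M j).dj Y))) ∧
      (∀ (j : Fin (k + 1)) (Y : (domSys (F.P K) M j).Dom), AnalyticOnNhd ℂ (old j Y) (sp j Y))} :=
  recAdmissible_of_stepGen₂ F K G D sp sp' hrestr (stepGen_of_stepGenT₂ F K G D sp sp' c hL hLc hN Tm hgenT) hA hr₁ hrate hsmall hrenew

end StepT

/-! ## §2 The term-indexed generator on a pair -/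

section OfTerms

variable (F : T4Family) (K : ℕ) {𝔸 : Type} [NormedRing 𝔸] [NormedAlgebra ℂ 𝔸] {M : ℕ} [NeZero M] (L : ℕ) [NeZero L]

open Classical in
/-- **(T-an₂) + (T-226₂) ⟹ (GEN₂) AT `GenTower.ofTerms L T`**: admissible older terms ON `sp` ⟹ every term `φ ↦ T k Z (𝐃,P) t old φ` analytic at the points of `sp′ (k+1) Z`
and `‖·‖ ≤ weight(𝐃,P)·e^{a₅|Z|}` there ⟹ the activities analytic and (2.38)-bounded on `sp′ (k+1)` (file 23 §1's collapse read with the step's clauses on `sp′`, then §1).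
[cite: Balaban1988RG2Cluster, (2.14) p.15, (2.26) p.17 and Lemma 3 (2.38) p.20] -/
theorem stepGen_ofTerms_of_termwise₂ (T : GenTermFun (F.P K) 𝔸 M L) (D : Set ℂ)
    (sp sp' : (j : ℕ) → (domSys (F.P K) M j).Dom → Set (CPair (F.P K) 𝔸)) {E₀ r₁ : ℝ} (c : B13.Consts) (hL : 8 ≤ c.L) (hLc : c.L = L)
    {a a₂ a₂' a₅ Aabs : ℝ} (hN : Lemma3Numerics c M ((c.L : ℝ) / 2) a a₂ a₂' a₅ Aabs)
    (hTan : ∀ k : ℕ, ∀ t ∈ D, ∀ old : OlderTerms (F.P K) 𝔸 M k,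
      (∀ (j : Fin (k + 1)) (Y : (domSys (F.P K) M j).Dom), ∀ ψ ∈ sp j Y,
          ‖old j Y ψ‖ ≤ E₀ * Real.exp (-(r₁ * (domSys (F.P K) M j).dj Y))) →
      (∀ (j : Fin (k + 1)) (Y : (domSys (F.P K) M j).Dom), AnalyticOnNhd ℂ (old j Y) (sp j Y)) →
      ∀ (Z : (domSys (F.P K) M (k + 1)).Dom), ∀ τ ∈ terms L M Z, AnalyticOnNhd ℂ (fun φ => T k Z τ t old φ) (sp' (k + 1) Z))
    (hT226 : ∀ k : ℕ, ∀ t ∈ D, ∀ old : OlderTerms (F.P K) 𝔸 M k,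
      (∀ (j : Fin (k + 1)) (Y : (domSys (F.P K) M j).Dom), ∀ ψ ∈ sp j Y,
          ‖old j Y ψ‖ ≤ E₀ * Real.exp (-(r₁ * (domSys (F.P K) M j).dj Y))) →
      (∀ (j : Fin (k + 1)) (Y : (domSys (F.P K) M j).Dom), AnalyticOnNhd ℂ (old j Y) (sp j Y)) →
      ∀ (Z : (domSys (F.P K) M (k + 1)).Dom) (φ : CPair (F.P K) 𝔸), φ ∈ sp' (k + 1) Z → ∀ τ ∈ terms L M Z,
        ‖T k Z τ t old φ‖ ≤ weight L M c Z a τ * Real.exp (a₅ * ((Z.1).card : ℝ))) :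
    ∀ k : ℕ, ∀ t ∈ D, ∀ old : OlderTerms (F.P K) 𝔸 M k,
      (∀ (j : Fin (k + 1)) (Y : (domSys (F.P K) M j).Dom), ∀ ψ ∈ sp j Y,
          ‖old j Y ψ‖ ≤ E₀ * Real.exp (-(r₁ * (domSys (F.P K) M j).dj Y))) →
      (∀ (j : Fin (k + 1)) (Y : (domSys (F.P K) M j).Dom), AnalyticOnNhd ℂ (old j Y) (sp j Y)) →
      (∀ Z : (domSys (F.P K) M (k + 1)).Dom, AnalyticOnNhd ℂ (fun φ => (GenTower.ofTerms L T k).H t old φ Z) (sp' (k + 1) Z)) ∧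
      (∀ (Z : (domSys (F.P K) M (k + 1)).Dom), ∀ φ ∈ sp' (k + 1) Z,
          ‖(GenTower.ofTerms L T k).H t old φ Z‖ ≤
            c.C3act * c.ε₁ * Real.exp (-((1 - 8 * c.δ) * ((c.L : ℝ) / 2) * c.κ * (domSys (F.P K) M (k + 1)).dj Z))) := by
  refine stepGen_of_stepGenT₂ F K (GenTower.ofTerms L T) D sp sp' c hL hLc hN (fun k t old Z τ φ => T k Z τ t old φ) fun k t ht old hB hAn => ?_
  refine ⟨fun Z => ?_, fun Z φ _ => ?_, fun Z φ hφ τ hτ => hT226 k t ht old hB hAn Z φ hφ τ hτ⟩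
  · rw [GenTower.ofTerms_apply]
    exact (forall_mem_idx_ofTerms_iff L (T k) Z).2 fun τ hτ => by simpa only [ofTerms_T] using hTan k t ht old hB hAn Z τ hτ
  · rw [GenTower.ofTerms_apply]
    exact norm_H_ofTerms_le L (T k) t old φ Z

open Classical in
/-- **W1's `RecAdmissible` ON `sp` FOR THE TERM-INDEXED GENERATOR FROM (T-an₂) + (T-226₂)** (print's pair: the terms' schemas on the larger table, the clause `hrestr`).
[cite: Balaban1987RG1, §1 p.263 and Thm 1 p.259; Balaban1988RG2Cluster, (2.14) p.15, (2.26) p.17, p.15 and p.22] -/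
theorem recAdmissible_ofTerms_of_termwise₂ (T : GenTermFun (F.P K) 𝔸 M L) (D : Set ℂ)
    (sp sp' : (j : ℕ) → (domSys (F.P K) M j).Dom → Set (CPair (F.P K) 𝔸)) {E₀ r₁ : ℝ}
    (hrestr : ∀ k, ∀ X Z : (domSys (F.P K) M (k + 1)).Dom, Z.1 ⊆ X.1 → sp (k + 1) X ⊆ sp' (k + 1) Z)
    (c : B13.Consts) (hL : 8 ≤ c.L) (hLc : c.L = L) {a a₂ a₂' a₅ Aabs : ℝ} (hN : Lemma3Numerics c M ((c.L : ℝ) / 2) a a₂ a₂' a₅ Aabs)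
    (hTan : ∀ k : ℕ, ∀ t ∈ D, ∀ old : OlderTerms (F.P K) 𝔸 M k,
      (∀ (j : Fin (k + 1)) (Y : (domSys (F.P K) M j).Dom), ∀ ψ ∈ sp j Y,
          ‖old j Y ψ‖ ≤ E₀ * Real.exp (-(r₁ * (domSys (F.P K) M j).dj Y))) →
      (∀ (j : Fin (k + 1)) (Y : (domSys (F.P K) M j).Dom), AnalyticOnNhd ℂ (old j Y) (sp j Y)) →
      ∀ (Z : (domSys (F.P K) M (k + 1)).Dom), ∀ τ ∈ terms L M Z, AnalyticOnNhd ℂ (fun φ => T k Z τ t old φ) (sp' (k + 1) Z))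
    (hT226 : ∀ k : ℕ, ∀ t ∈ D, ∀ old : OlderTerms (F.P K) 𝔸 M k,
      (∀ (j : Fin (k + 1)) (Y : (domSys (F.P K) M j).Dom), ∀ ψ ∈ sp j Y,
          ‖old j Y ψ‖ ≤ E₀ * Real.exp (-(r₁ * (domSys (F.P K) M j).dj Y))) →
      (∀ (j : Fin (k + 1)) (Y : (domSys (F.P K) M j).Dom), AnalyticOnNhd ℂ (old j Y) (sp j Y)) →
      ∀ (Z : (domSys (F.P K) M (k + 1)).Dom) (φ : CPair (F.P K) 𝔸), φ ∈ sp' (k + 1) Z → ∀ τ ∈ terms L M Z,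
        ‖T k Z τ t old φ‖ ≤ weight L M c Z a τ * Real.exp (a₅ * ((Z.1).card : ℝ)))
    (hr₁ : 0 ≤ r₁) (hA : 0 ≤ c.C3act * c.ε₁) (hrate : r₁ + 2 * (64 * Real.log 162) + 2 ≤ (1 - 8 * c.δ) * ((c.L : ℝ) / 2) * c.κ)
    (hsmall : c.C3act * c.ε₁ * Real.exp (5 * r₁ + 1) * K₀ 64 8 * 9 * 64 < 1)
    (hrenew : Real.exp 1 * 9 * 64 * K₀ 64 8 ^ 2 * (c.C3act * c.ε₁) ≤ E₀) :
    RecAdmissible (GenTower.ofTerms L T) D fun k => {old : OlderTerms (F.P K) 𝔸 M k |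
      (∀ (j : Fin (k + 1)) (Y : (domSys (F.P K) M j).Dom), ∀ ψ ∈ sp j Y,
          ‖old j Y ψ‖ ≤ E₀ * Real.exp (-(r₁ * (domSys (F.P K) M j).dj Y))) ∧
      (∀ (j : Fin (k + 1)) (Y : (domSys (F.P K) M j).Dom), AnalyticOnNhd ℂ (old j Y) (sp j Y))} :=
  recAdmissible_of_stepGen₂ F K (GenTower.ofTerms L T) D sp sp' hrestr (stepGen_ofTerms_of_termwise₂ F K L T D sp sp' c hL hLc hN hTan hT226) hA hr₁
    hrate hsmall hrenew

end OfTerms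

/-! ## §2b L05 at the admissible pairing of record, term-indexed generator on a pair -/

section Admissible

variable (F : T4Family) (M N k : ℕ) [NeZero M] (L : ℕ) [NeZero L] (sp : (k j : ℕ) → (domSys (F.P k) M j).Dom → Set (CPair (F.P k) (MatA N)))
  (gauge : GaugeField (F.P k) 0 (Node00.SU N) → GaugeField (F.P k) 0 (Node00.SU N) → ℝ) (hg : ∀ U U', 0 ≤ gauge U U')
  (T₀ : GaugeField (F.P (k + 1)) 0 (Node00.SU N) → GaugeField (F.P k) 0 (Node00.SU N))
  (hT₀ : ∀ U : GaugeField (F.P (k + 1)) 0 (Node00.SU N),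
    (∀ (j : ℕ) (Y : (domSys (F.P (k + 1)) M j).Dom), ofBackgroundC (ιSU N) U ∈ sp (k + 1) j Y) →
      ∀ (j : ℕ) (Y : (domSys (F.P k) M j).Dom), ofBackgroundC (ιSU N) (T₀ U) ∈ sp k j Y)

open Classical in
/-- **★ L05 AT THE ADMISSIBLE PAIRING OF RECORD FOR `toClusterTower (GenTower.ofTerms L T)` ON A PAIR**: readings and older terms in `sp k`, the terms' schemas (T-an₂) ∕
(T-226₂) on a LARGER family `spA′` linked by print's clause, ONE numerics bundle, the clauses, `]0,γ] ⊆ D` ⟹ `DecayBound ((LevelPairing.ofRecordAdm …).EA (toClusterTower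
(GenTower.ofTerms L T))) (Window γ) E₀ r₁` (file 22 §4 on §2). [cite: Balaban1987RG1, (0.25) p.257, (1.18) p.263 and Thm 1 p.259; Balaban1988RG2Cluster, (2.14) p.15, (2.26) p.17, p.15 and p.22] -/
theorem decayBound_EA_ofRecordAdm_ofTerms_of_termwise₂ (T : GenTermFun (F.P k) (MatA N) M L) (D : Set ℂ)
    (spA' : (j : ℕ) → (domSys (F.P k) M j).Dom → Set (CPair (F.P k) (MatA N))) {E₀ r₁ γ : ℝ}
    (hrestr : ∀ m, ∀ X Z : (domSys (F.P k) M (m + 1)).Dom, Z.1 ⊆ X.1 → sp k (m + 1) X ⊆ spA' (m + 1) Z)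
    (c : B13.Consts) (hL : 8 ≤ c.L) (hLc : c.L = L) {a a₂ a₂' a₅ Aabs : ℝ} (hN : Lemma3Numerics c M ((c.L : ℝ) / 2) a a₂ a₂' a₅ Aabs)
    (hTan : ∀ m : ℕ, ∀ t ∈ D, ∀ old : OlderTerms (F.P k) (MatA N) M m,
      (∀ (j : Fin (m + 1)) (Y : (domSys (F.P k) M j).Dom), ∀ ψ ∈ sp k j Y,
          ‖old j Y ψ‖ ≤ E₀ * Real.exp (-(r₁ * (domSys (F.P k) M j).dj Y))) →
      (∀ (j : Fin (m + 1)) (Y : (domSys (F.P k) M j).Dom), AnalyticOnNhd ℂ (old j Y) (sp k j Y)) →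
      ∀ (Z : (domSys (F.P k) M (m + 1)).Dom), ∀ τ ∈ terms L M Z, AnalyticOnNhd ℂ (fun φ => T m Z τ t old φ) (spA' (m + 1) Z))
    (hT226 : ∀ m : ℕ, ∀ t ∈ D, ∀ old : OlderTerms (F.P k) (MatA N) M m,
      (∀ (j : Fin (m + 1)) (Y : (domSys (F.P k) M j).Dom), ∀ ψ ∈ sp k j Y,
          ‖old j Y ψ‖ ≤ E₀ * Real.exp (-(r₁ * (domSys (F.P k) M j).dj Y))) →
      (∀ (j : Fin (m + 1)) (Y : (domSys (F.P k) M j).Dom), AnalyticOnNhd ℂ (old j Y) (sp k j Y)) →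
      ∀ (Z : (domSys (F.P k) M (m + 1)).Dom) (φ : CPair (F.P k) (MatA N)), φ ∈ spA' (m + 1) Z → ∀ τ ∈ terms L M Z,
        ‖T m Z τ t old φ‖ ≤ weight L M c Z a τ * Real.exp (a₅ * ((Z.1).card : ℝ)))
    (hr₁ : 0 ≤ r₁) (hA : 0 ≤ c.C3act * c.ε₁) (hrate : r₁ + 2 * (64 * Real.log 162) + 2 ≤ (1 - 8 * c.δ) * ((c.L : ℝ) / 2) * c.κ)
    (hsmall : c.C3act * c.ε₁ * Real.exp (5 * r₁ + 1) * K₀ 64 8 * 9 * 64 < 1)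
    (hrenew : Real.exp 1 * 9 * 64 * K₀ 64 8 ^ 2 * (c.C3act * c.ε₁) ≤ E₀) (hD : ∀ s ∈ Ioc (0 : ℝ) γ, ((s : ℝ) : ℂ) ∈ D) :
    DecayBound ((LevelPairing.ofRecordAdm F M N k sp gauge hg T₀ hT₀).EA (toClusterTower (GenTower.ofTerms L T))) (Window γ) E₀ r₁ :=
  decayBound_EA_ofRecordAdm_toClusterTower_of_stepGen₂ F M N k sp gauge hg T₀ hT₀ (GenTower.ofTerms L T) D spA' hrestr
    (stepGen_ofTerms_of_termwise₂ F k L T D (sp k) spA' c hL hLc hN hTan hT226) hA hr₁ hrate hsmall hrenew hD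

end Admissible

/-! ## §3 At the tree's witness numerals, on the pair -/

section Witness

variable (F : T4Family) (K : ℕ) {𝔸 : Type} [NormedRing 𝔸] [NormedAlgebra ℂ 𝔸] {M : ℕ} [NeZero M]

open Literature.MathematicalPhysics.QuantumFieldTheory.Balaban1983to89.B13Lemma3WindowNonvacuity (aw)
open Literature.MathematicalPhysics.QuantumFieldTheory.Balaban1983to89.B13Lemma3TorusNonvacuity (consts)
open Summit.QuantumFields.YangMills.BalabanUVNodes.N18HLayerW1NumeralsStrict (chainNumerals_consts_anyM)

open Classical in
/-- **★★ W1's `RecAdmissible` ON `sp` FOR THE TERM-INDEXED GENERATOR, PRINT's PAIR, WITNESS NUMERALS** (file 19 §2: `consts`, block factor `8`, rate `aw + 40M`, `a₅ = ½`,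
(1.18)-letters `(consts.E₀, consts.κ)`): hypotheses = (T-an₂) + (T-226₂ at the witness weights) ON THE LARGER TABLES `sp′` + print's clause `hrestr` ONLY — the cleanest
statement of what NODE A owes per printed term for a term-functional family, with every numeric clause discharged and the restriction in print's shape.
[cite: Balaban1987RG1, §1 p.263 and Thm 1 p.259; Balaban1988RG2Cluster, (2.14) p.15, p.15 (the restriction), (2.26) p.17, p.21 (closing paragraph), p.22] -/
theorem recAdmissible_ofTerms_of_termwise₂_consts (T : GenTermFun (F.P K) 𝔸 M 8) (D : Set ℂ)
    (sp sp' : (j : ℕ) → (domSys (F.P K) M j).Dom → Set (CPair (F.P K) 𝔸))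
    (hrestr : ∀ k, ∀ X Z : (domSys (F.P K) M (k + 1)).Dom, Z.1 ⊆ X.1 → sp (k + 1) X ⊆ sp' (k + 1) Z)
    (hTan : ∀ k : ℕ, ∀ t ∈ D, ∀ old : OlderTerms (F.P K) 𝔸 M k,
      (∀ (j : Fin (k + 1)) (Y : (domSys (F.P K) M j).Dom), ∀ ψ ∈ sp j Y,
          ‖old j Y ψ‖ ≤ consts.E₀ * Real.exp (-(consts.κ * (domSys (F.P K) M j).dj Y))) →
      (∀ (j : Fin (k + 1)) (Y : (domSys (F.P K) M j).Dom), AnalyticOnNhd ℂ (old j Y) (sp j Y)) →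
      ∀ (Z : (domSys (F.P K) M (k + 1)).Dom), ∀ τ ∈ terms 8 M Z, AnalyticOnNhd ℂ (fun φ => T k Z τ t old φ) (sp' (k + 1) Z))
    (hT226 : ∀ k : ℕ, ∀ t ∈ D, ∀ old : OlderTerms (F.P K) 𝔸 M k,
      (∀ (j : Fin (k + 1)) (Y : (domSys (F.P K) M j).Dom), ∀ ψ ∈ sp j Y,
          ‖old j Y ψ‖ ≤ consts.E₀ * Real.exp (-(consts.κ * (domSys (F.P K) M j).dj Y))) →
      (∀ (j : Fin (k + 1)) (Y : (domSys (F.P K) M j).Dom), AnalyticOnNhd ℂ (old j Y) (sp j Y)) →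
      ∀ (Z : (domSys (F.P K) M (k + 1)).Dom) (φ : CPair (F.P K) 𝔸), φ ∈ sp' (k + 1) Z → ∀ τ ∈ terms 8 M Z,
        ‖T k Z τ t old φ‖ ≤ weight 8 M consts Z (aw + 40 * (M : ℝ)) τ * Real.exp (1 / 2 * ((Z.1).card : ℝ))) :
    RecAdmissible (GenTower.ofTerms 8 T) D fun k => {old : OlderTerms (F.P K) 𝔸 M k |
      (∀ (j : Fin (k + 1)) (Y : (domSys (F.P K) M j).Dom), ∀ ψ ∈ sp j Y,
          ‖old j Y ψ‖ ≤ consts.E₀ * Real.exp (-(consts.κ * (domSys (F.P K) M j).dj Y))) ∧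
      (∀ (j : Fin (k + 1)) (Y : (domSys (F.P K) M j).Dom), AnalyticOnNhd ℂ (old j Y) (sp j Y))} := by
  obtain ⟨hL, hL8, hN, hκ, hC3pos, hlarge, hsmall, hrenew, -⟩ := chainNumerals_consts_anyM M
  exact recAdmissible_ofTerms_of_termwise₂ F K 8 T D sp sp' hrestr consts hL hL8 hN hTan hT226 hκ hC3pos hlarge hsmall hrenew

end Witness

end Summit.QuantumFields.YangMills.BalabanUVNodes.N18HLayerW1TwoRadiiTerms

end
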